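import Literature.NumberTheory.LFunctions.RiemannSiegelThetaBounds
import Literature.NumberTheory.LFunctions.RiemannSiegelFacts
import Mathlib.Analysis.SpecialFunctions.Integrals.Basic
import Summits.RiemannHypothesis.RiemannHypothesis.Theorems.LiCoefficientsDefs
import HarnessLib

/-!
# RiemannHypothesis / LiCoefficients — crux `LiWindowLowerBound`, part B (RH-FREE): the oscillatory ϑ-term (S3)

`|(1/π)∫_{b/2}^b ϑ' − (1/π)∫_{b/2}^b f_n ϑ'| = (1/π)|∫_{b/2}^b ϑ'(t) cos(nθ(t)) dt| ≤ 0.36 (b²/n) log(b/2π) + 0.45`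
for `n ≥ 1`, `b ≥ 1100`: write `ϑ' = ½ log(t/2π) + E`, `|E| ≤ 2/t` (`abs_riemannSiegelThetaDeriv_sub_log_le`),
so `∫ E cos ≤ 2 log 2`; and integrate `½ log(t/2π) cos(nθ) = h · (sin nθ)'` by parts with the monotone
amplitude `h = −log(t/2π)(4t²+1)/(8n)` (no stationary point: `(nθ)' = −4n/(4t²+1) ≠ 0`), giving
`|∫ ½ log(t/2π) cos(nθ)| ≤ 2|h(b)| = log(b/2π)(4b²+1)/(4n)`.

RH-FREE [rh-li-prover]: every input is a proved tree theorem about the zeros of `ζ` (zero counting, Backlund's explicit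
`S(t)` bound, Turing's bound, Stirling for `ϑ`); no hypothesis on the real parts of the zeros is used.  Part of the
PROOF-OF-DATA rung L-P(P1) of the RH ladder's column LI; nothing here bears on the truth of RH.
-/

noncomputable section

-- D-0017: `Summit.<S>.<S>.…` is the designed namespace of a single-problem summit.
set_option linter.dupNamespace false

open Real Set MeasureTheory intervalIntegral Filter
open scoped Real Topology

namespace Summit.RiemannHypothesis.RiemannHypothesis.Theorems.LiTheory

open Literature.NumberTheory.LFunctions

namespace Window

/-- The error part: `|∫_{b/2}^b cos(nθ) (ϑ' − ½ log(t/2π))| ≤ 2 log 2` (`b ≥ 2`). -/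
theorem abs_integral_cos_mul_err_le (n : ℕ) {b : ℝ} (hb : 2 ≤ b) :
    |∫ t in (b / 2)..b, Real.cos (n * liZeroAngle t) *
        (riemannSiegelThetaDeriv t - Real.log (t / (2 * π)) / 2)| ≤ 2 * Real.log 2 := by
  have ha0 : 0 < b / 2 := by linarith
  have hab : b / 2 ≤ b := by linarith
  have hle : ∀ᵐ t ∂volume, t ∈ Ioc (b / 2) b →
      ‖Real.cos (n * liZeroAngle t) * (riemannSiegelThetaDeriv t - Real.log (t / (2 * π)) / 2)‖ ≤
        2 * t⁻¹ :=
    Filter.Eventually.of_forall fun t ht ↦ by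
      have ht1 : 1 ≤ t := by linarith [ht.1]
      have ht0 : 0 < t := by linarith
      rw [Real.norm_eq_abs, abs_mul]
      have hc := Real.abs_cos_le_one (n * liZeroAngle t)
      have hE := abs_riemannSiegelThetaDeriv_sub_log_le ht1
      calc |Real.cos (n * liZeroAngle t)| * |riemannSiegelThetaDeriv t - Real.log (t / (2 * π)) / 2|
          ≤ 1 * (2 / t) := mul_le_mul hc hE (abs_nonneg _) zero_le_one
        _ = 2 * t⁻¹ := by ring
  have hint : IntervalIntegrable (fun t : ℝ ↦ 2 * t⁻¹) volume (b / 2) b := by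
    refine (continuousOn_of_forall_continuousAt fun t ht ↦ ?_).intervalIntegrable
    rw [uIcc_of_le hab] at ht
    have ht0 : t ≠ 0 := by linarith [ht.1]
    fun_prop (disch := assumption)
  have h := intervalIntegral.norm_integral_le_of_norm_le hab hle hint
  rw [intervalIntegral.integral_const_mul, integral_inv_of_pos ha0 (by linarith),
    show b / (b / 2) = 2 by field_simp, Real.norm_eq_abs] at h
  exact h

/-- The main part, by parts with a monotone amplitude: for `n ≥ 1`, `b ≥ 1100`,
`|∫_{b/2}^b cos(nθ(t)) ½ log(t/2π) dt| ≤ log(b/2π)(4b²+1)/(4n)`. -/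
theorem abs_integral_cos_mul_log_le (n : ℕ) {b : ℝ} (hn : 1 ≤ n) (hb : 1100 ≤ b) :
    |∫ t in (b / 2)..b, Real.cos (n * liZeroAngle t) * (Real.log (t / (2 * π)) / 2)| ≤
      Real.log (b / (2 * π)) * (4 * b ^ 2 + 1) / (4 * n) := by
  have hπ := Real.pi_lt_d4
  have hπ0 := Real.pi_pos
  have ha0 : 0 < b / 2 := by linarith
  have hab : b / 2 ≤ b := by linarith
  have hn0 : (0 : ℝ) < n := by exact_mod_cast hn
  set a := b / 2 with ha
  -- the amplitude `h` and its derivative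
  set h : ℝ → ℝ := fun t ↦ -(Real.log (t / (2 * π)) * (4 * t ^ 2 + 1)) / (8 * n) with hh
  set h' : ℝ → ℝ := fun t ↦ -((4 * t ^ 2 + 1) / t + 8 * t * Real.log (t / (2 * π))) / (8 * n) with hh'
  set φ' : ℝ → ℝ := fun t ↦ (n : ℝ) * (-4 / (4 * t ^ 2 + 1)) with hφ'
  have hlogpos : ∀ t ∈ Icc a b, 0 ≤ Real.log (t / (2 * π)) := fun t ht ↦
    Real.log_nonneg (by rw [le_div_iff₀ (by positivity)]; linarith [ht.1])
  have hderiv_h : ∀ t ∈ uIcc a b, HasDerivAt h (h' t) t := by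
    intro t ht
    rw [uIcc_of_le hab] at ht
    have ht0 : t ≠ 0 := by linarith [ht.1]
    have hl : HasDerivAt (fun y : ℝ ↦ Real.log (y / (2 * π))) (t⁻¹) t := by
      have h1 : HasDerivAt (fun y : ℝ ↦ y / (2 * π)) (1 / (2 * π)) t := (hasDerivAt_id' t).div_const _
      have h2 := (Real.hasDerivAt_log (show t / (2 * π) ≠ 0 by positivity)).comp t h1
      refine h2.congr_deriv ?_
      field_simp
    have hp : HasDerivAt (fun y : ℝ ↦ 4 * y ^ 2 + 1) (4 * (2 * t ^ 1 * 1) + 0) t :=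
      (((hasDerivAt_id' t).pow 2).const_mul 4).add (hasDerivAt_const t 1)
    have h3 := ((hl.mul hp).neg).div_const (8 * (n : ℝ))
    refine (h3.congr_of_eventuallyEq (Filter.Eventually.of_forall fun y ↦ rfl)).congr_deriv ?_
    simp only [hh']
    field_simp
    ring
  have hderiv_v : ∀ t ∈ uIcc a b, HasDerivAt (fun y ↦ Real.sin (n * liZeroAngle y))
      (Real.cos (n * liZeroAngle t) * φ' t) t := by
    intro t ht
    rw [uIcc_of_le hab] at ht
    have ht0 : t ≠ 0 := by linarith [ht.1]
    exact ((hasDerivAt_liZeroAngle ht0).const_mul (n : ℝ)).sin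
  have hcont_h' : ContinuousOn h' (Icc a b) := by
    refine continuousOn_of_forall_continuousAt fun t ht ↦ ?_
    have ht0 : t ≠ 0 := by linarith [ht.1]
    have h2π : t / (2 * π) ≠ 0 := by
      have : 0 < t := by linarith [ht.1]
      positivity
    simp only [hh']
    fun_prop (disch := assumption)
  have hcont_v' : ContinuousOn (fun t ↦ Real.cos (n * liZeroAngle t) * φ' t) (Icc a b) := by
    have hθ : ContinuousOn liZeroAngle (Icc a b) := fun t ht ↦
      (hasDerivAt_liZeroAngle (by linarith [ht.1] : t ≠ 0)).continuousAt.continuousWithinAt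
    have hcos : ContinuousOn (fun t ↦ Real.cos (n * liZeroAngle t)) (Icc a b) :=
      Real.continuous_cos.comp_continuousOn (continuousOn_const.mul hθ)
    refine hcos.mul ?_
    simp only [hφ']
    refine continuousOn_const.mul (continuousOn_const.div (by fun_prop) fun t _ ↦ by positivity)
  -- rewrite the integrand as `h · (sin nθ)'`
  have hrew : ∀ t ∈ Icc a b, Real.cos (n * liZeroAngle t) * (Real.log (t / (2 * π)) / 2) =
      h t * (Real.cos (n * liZeroAngle t) * φ' t) := by
    intro t ht
    have h4 : (4 : ℝ) * t ^ 2 + 1 ≠ 0 := by positivity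
    simp only [hh, hφ']
    field_simp
    ring
  have hI : ∫ t in a..b, Real.cos (n * liZeroAngle t) * (Real.log (t / (2 * π)) / 2) =
      ∫ t in a..b, h t * (Real.cos (n * liZeroAngle t) * φ' t) :=
    intervalIntegral.integral_congr fun t ht ↦ hrew t (by rwa [uIcc_of_le hab] at ht)
  have hparts := intervalIntegral.integral_mul_deriv_eq_deriv_mul hderiv_h hderiv_v
    (hcont_h'.intervalIntegrable_of_Icc hab) (hcont_v'.intervalIntegrable_of_Icc hab)
  rw [hI, hparts]
  -- signs: `h ≤ 0`, `h' ≤ 0` on `[a, b]`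
  have hh_nonpos : ∀ t ∈ Icc a b, h t ≤ 0 := by
    intro t ht
    simp only [hh]
    have := hlogpos t ht
    have : 0 ≤ Real.log (t / (2 * π)) * (4 * t ^ 2 + 1) := by positivity
    apply div_nonpos_of_nonpos_of_nonneg (by linarith) (by positivity)
  have hh'_nonpos : ∀ t ∈ Icc a b, h' t ≤ 0 := by
    intro t ht
    simp only [hh']
    have ht0 : 0 < t := by linarith [ht.1]
    have := hlogpos t ht
    have : 0 ≤ (4 * t ^ 2 + 1) / t + 8 * t * Real.log (t / (2 * π)) := by positivity
    apply div_nonpos_of_nonpos_of_nonneg (by linarith) (by positivity)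
  -- the integral of `h' sin`
  have hFTC : ∫ t in a..b, h' t = h b - h a :=
    integral_eq_sub_of_hasDerivAt hderiv_h (hcont_h'.intervalIntegrable_of_Icc hab)
  have hI2 : |∫ t in a..b, h' t * Real.sin (n * liZeroAngle t)| ≤ h a - h b := by
    have hle : ∀ᵐ t ∂volume, t ∈ Ioc a b → ‖h' t * Real.sin (n * liZeroAngle t)‖ ≤ -h' t :=
      Filter.Eventually.of_forall fun t ht ↦ by
        rw [Real.norm_eq_abs, abs_mul]
        have hs := Real.abs_sin_le_one (n * liZeroAngle t)
        have h0 := hh'_nonpos t ⟨ht.1.le, ht.2⟩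
        rw [abs_of_nonpos h0]
        nlinarith [abs_nonneg (h' t)]
    have h := intervalIntegral.norm_integral_le_of_norm_le hab hle
      ((hcont_h'.intervalIntegrable_of_Icc hab).neg)
    rw [intervalIntegral.integral_neg, hFTC, Real.norm_eq_abs] at h
    linarith
  have hsa := Real.abs_sin_le_one (n * liZeroAngle a)
  have hsb := Real.abs_sin_le_one (n * liZeroAngle b)
  have hha := hh_nonpos a ⟨le_rfl, hab⟩
  have hhb := hh_nonpos b ⟨hab, le_rfl⟩
  have hb1 : |h b * Real.sin (n * liZeroAngle b)| ≤ -h b := by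
    rw [abs_mul, abs_of_nonpos hhb]; nlinarith [abs_nonneg (h b)]
  have hb2 : |h a * Real.sin (n * liZeroAngle a)| ≤ -h a := by
    rw [abs_mul, abs_of_nonpos hha]; nlinarith [abs_nonneg (h a)]
  have hval : -h b = Real.log (b / (2 * π)) * (4 * b ^ 2 + 1) / (8 * n) := by
    simp only [hh]; ring
  calc |h b * Real.sin (n * liZeroAngle b) - h a * Real.sin (n * liZeroAngle a) -
        ∫ t in a..b, h' t * Real.sin (n * liZeroAngle t)|
      ≤ |h b * Real.sin (n * liZeroAngle b)| + |h a * Real.sin (n * liZeroAngle a)| +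
        |∫ t in a..b, h' t * Real.sin (n * liZeroAngle t)| := by
          refine (abs_sub _ _).trans (add_le_add (abs_sub _ _) le_rfl)
    _ ≤ -h b + -h a + (h a - h b) := by linarith
    _ = Real.log (b / (2 * π)) * (4 * b ^ 2 + 1) / (4 * n) := by rw [show -h b + -h a + (h a - h b) = 2 * (-h b) by ring, hval]; ring

/-- **S3 (the oscillatory ϑ-term).**  For `n ≥ 1`, `b ≥ 1100`:
`|(1/π)∫_{b/2}^b ϑ' − (1/π)∫_{b/2}^b f_n ϑ'| ≤ 0.36 (b²/n) log(b/2π) + 0.45`. -/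
theorem thetaOsc (n : ℕ) {b : ℝ} (hn : 1 ≤ n) (hb : 1100 ≤ b) :
    |1 / Real.pi * (∫ t in (b / 2)..b, riemannSiegelThetaDeriv t) -
        1 / Real.pi * (∫ t in (b / 2)..b, liWindowWeight n t * riemannSiegelThetaDeriv t)| ≤
      0.36 * (b ^ 2 / n) * Real.log (b / (2 * Real.pi)) + 0.45 := by
  have hπ := Real.pi_gt_d4
  have hπ' := Real.pi_lt_d4
  have hπ0 := Real.pi_pos
  have ha0 : 0 < b / 2 := by linarith
  have hab : b / 2 ≤ b := by linarith
  have hn0 : (0 : ℝ) < n := by exact_mod_cast hn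
  -- continuity on `[b/2, b]`
  have hθ : ContinuousOn liZeroAngle (uIcc (b / 2) b) := fun t ht ↦ by
    rw [uIcc_of_le hab] at ht
    exact (hasDerivAt_liZeroAngle (by linarith [ht.1] : t ≠ 0)).continuousAt.continuousWithinAt
  have hcos : ContinuousOn (fun t ↦ Real.cos (n * liZeroAngle t)) (uIcc (b / 2) b) :=
    Real.continuous_cos.comp_continuousOn (continuousOn_const.mul hθ)
  have hϑ' : Continuous riemannSiegelThetaDeriv := continuous_riemannSiegelThetaDeriv_holds
  have hlogc : ContinuousOn (fun t : ℝ ↦ Real.log (t / (2 * π)) / 2) (uIcc (b / 2) b) := by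
    refine continuousOn_of_forall_continuousAt fun t ht ↦ ?_
    rw [uIcc_of_le hab] at ht
    have : t / (2 * π) ≠ 0 := by have : 0 < t := by linarith [ht.1]
                                 positivity
    fun_prop (disch := assumption)
  have i1 : IntervalIntegrable riemannSiegelThetaDeriv volume (b / 2) b := hϑ'.intervalIntegrable _ _
  have i2 : IntervalIntegrable (fun t ↦ liWindowWeight n t * riemannSiegelThetaDeriv t) volume (b / 2) b := by
    refine ContinuousOn.intervalIntegrable ?_
    exact (continuousOn_const.sub hcos).mul hϑ'.continuousOn
  have i3 : IntervalIntegrable (fun t ↦ Real.cos (n * liZeroAngle t) * (Real.log (t / (2 * π)) / 2))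
      volume (b / 2) b := (hcos.mul hlogc).intervalIntegrable
  have i4 : IntervalIntegrable (fun t ↦ Real.cos (n * liZeroAngle t) *
      (riemannSiegelThetaDeriv t - Real.log (t / (2 * π)) / 2)) volume (b / 2) b :=
    (hcos.mul (hϑ'.continuousOn.sub hlogc)).intervalIntegrable
  -- combine the two integrals
  have hcomb : 1 / π * (∫ t in (b / 2)..b, riemannSiegelThetaDeriv t) -
      1 / π * (∫ t in (b / 2)..b, liWindowWeight n t * riemannSiegelThetaDeriv t) =
      1 / π * ((∫ t in (b / 2)..b, Real.cos (n * liZeroAngle t) * (Real.log (t / (2 * π)) / 2)) +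
        ∫ t in (b / 2)..b, Real.cos (n * liZeroAngle t) *
          (riemannSiegelThetaDeriv t - Real.log (t / (2 * π)) / 2)) := by
    rw [← mul_sub, ← intervalIntegral.integral_sub i1 i2, ← intervalIntegral.integral_add i3 i4]
    congr 1
    refine intervalIntegral.integral_congr fun t _ ↦ ?_
    simp only [liWindowWeight]
    ring
  rw [hcomb, abs_mul, abs_of_pos (by positivity : (0 : ℝ) < 1 / π)]
  have hA := abs_integral_cos_mul_log_le n hn hb
  have hB := abs_integral_cos_mul_err_le n (b := b) (by linarith)
  have hlog2 := Real.log_two_lt_d9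
  have hL0 : 0 ≤ Real.log (b / (2 * π)) :=
    Real.log_nonneg (by rw [le_div_iff₀ (by positivity)]; linarith)
  set L := Real.log (b / (2 * π)) with hL
  have hsum := (abs_add_le _ _).trans (add_le_add hA hB)
  -- numerics: (1/π)(L(4b²+1)/(4n) + 2 log 2) ≤ 0.36 (b²/n) L + 0.45
  have hkey : L * (4 * b ^ 2 + 1) / (4 * n) ≤ π * (0.36 * (b ^ 2 / n) * L) := by
    rw [div_le_iff₀ (by positivity)]
    have : L * (4 * b ^ 2 + 1) ≤ L * (π * 0.36 * 4 * b ^ 2) := by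
      refine mul_le_mul_of_nonneg_left ?_ hL0
      nlinarith
    have e : π * (0.36 * (b ^ 2 / n) * L) * (4 * n) = L * (π * 0.36 * 4 * b ^ 2) := by
      field_simp
    linarith
  have hkey2 : 2 * Real.log 2 ≤ π * 0.45 := by nlinarith
  calc 1 / π * |(∫ t in (b / 2)..b, Real.cos (n * liZeroAngle t) * (Real.log (t / (2 * π)) / 2)) +
        ∫ t in (b / 2)..b, Real.cos (n * liZeroAngle t) * (riemannSiegelThetaDeriv t - Real.log (t / (2 * π)) / 2)|
      ≤ 1 / π * (π * (0.36 * (b ^ 2 / n) * L) + π * 0.45) := by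
        refine mul_le_mul_of_nonneg_left (hsum.trans (add_le_add hkey hkey2)) (by positivity)
    _ = 0.36 * (b ^ 2 / n) * L + 0.45 := by field_simp

end Window

end Summit.RiemannHypothesis.RiemannHypothesis.Theorems.LiTheory

end
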